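import Summits.ValiantsHypothesis.ValiantsHypothesis.Theses.FifoMatching
import Summits.ValiantsHypothesis.ValiantsHypothesis.Theorems.FifoMatchingNNInVNPRecogniser

/-!
# Route FifoMatching — `NNInVNP` (stmt-ValiantsHypothesis-11618)

The nest-free (FIFO, "nonnesting") perfect matching family
`NN_n = ∑_{M} [M a nest-free fixed-point-free involution of [2n]] ∏_{i < M i} x_{i, M i}`
is a `VNP` family over `ℂ` (hypothesis of the route's deciding theorem `closes`).

Proof (Valiant 1979; Bürgisser–Clausen–Shokrollahi 1997, Prop. (21.15), the pattern used for the
permanent and the Hamiltonian cycle family in `ValiantConjectureProofs.lean` /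
`HamiltonianCycleVNP.lean`): `NN_N(X) = ∑_{E ∈ {0,1}^{[N]×[N]}} G_N(X, E)` for the witness
`G_N = α · ω · β · μ` (`nnWitness`, file `FifoMatchingNNInVNPDefs.lean`) with

* `α = ∏ (1 - Y_a Y_b)` over the ordered pairs of distinct CONFLICTING arcs `a, b` (sharing an
  endpoint, or `a` nesting `b`: `a.1 < b.1 < b.2 < a.2`),
* `ω = ∏_{a : ¬ a.1 < a.2} (1 - Y_a)` (only oriented arcs `i < j` may be used),
* `β = ∏_{v} ∑_{a ∋ v} Y_a` (every vertex is covered),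
* `μ = ∏_a (1 - Y_a + Y_a X_a)` (the cover product: the monomial of the chosen arcs).

At a Boolean point `E`, `α ω β ∈ {0, 1}` and equals `1` exactly when `E` is the arc set
`{(i, M i) : i < M i}` of a nest-free fixed-point-free involution `M`
(`FifoMatchingNNInVNPRecogniser.lean`), where `μ` evaluates to `∏_{i < M i} X_{(i, M i)}`
(`boolSum_nnWitness`). The witness has `2N²` variables, degree `≤ 2N⁴ + 3N² + N` and complexity
`≤ 4N⁴ + N³ + 8N² + N + 3` by the cost calculus of `ArithCircuitProofs` (`L(f+g), L(fg) ≤ L(f) + L(g) + 1`),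
so it is a `VP` family and `NN ∈ VNP` is literally Bürgisser 2000, Def. 2.5 (`IsVNPFamily`) with Boolean
block `Fin (N·N)`, `N = 2n` (`isVNPFamily_nnPoly`, `nnInVNP_proof`).

Honest framing: a membership lemma (`NN ∈ VNP`) for the route's candidate family; the route's
crux `NNNotVP` is open and nothing here bears on `VP ≠ VNP`.
-/

set_option linter.dupNamespace false -- single-conjunct summit: `ValiantsHypothesis.ValiantsHypothesis`

noncomputable section

open MvPolynomial

universe u

namespace Summit.ValiantsHypothesis.ValiantsHypothesis.Theorems.FifoMatching

open Literature.Computability.AlgebraicComplexity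
open Summit.ValiantsHypothesis.ValiantsHypothesis.Theses.FifoMatching

/-! ### `NN_N` is the Boolean sum of the witness -/

section Witness

variable (N : ℕ) (k : Type u) [CommRing k]

/-- **`NN_N` is the Boolean sum of the witness** over the Boolean arc variables:
`∑_{E ∈ {0,1}^{[N]×[N]}} G_N(X, E) = ∑_{M nest-free matching} ∏_{i < M i} X_{(i, M i)} = NN_N(X)`
(BCS 1997, Prop. (21.15): (A)–(D) for the recogniser). [cite: BurgisserClausenShokrollahi1997, Prop. (21.15)] -/
theorem boolSum_nnWitness : boolSum (nnWitness N k) = nnPoly N k := by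
  unfold boolSum nnWitness nnAlpha nnOmega nnBeta nnCover
  simp only [map_mul, map_prod, map_sum, map_sub, map_add, map_one, aeval_X, Sum.elim_inl,
    Sum.elim_inr]
  rw [← Equiv.sum_comp (Equiv.arrowCongr finProdFinEquiv (Equiv.refl Bool))]
  simp only [Equiv.arrowCongr_apply, Equiv.coe_refl, Function.comp_apply, id_eq,
    Equiv.symm_apply_apply]
  refine (sum_nnRecogniserVal_mul (R := MvPolynomial (Fin N × Fin N) k) _).trans ?_
  rw [nnPoly, nnMatchings, Finset.sum_filter]
  refine Finset.sum_congr rfl fun M _ => ?_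
  split_ifs with hM
  · exact prod_cover_arcSet M
  · rfl

end Witness

/-! ### Size of the witness: variables, degree, complexity -/

section Bounds

variable (N : ℕ) (k : Type u) [CommRing k]

/-- A filter of the arcs has at most `N²` elements. [folklore] -/
theorem card_filter_arcs_le (p : Fin N × Fin N → Prop) [DecidablePred p] :
    (Finset.univ.filter p).card ≤ N * N := by
  refine (Finset.card_filter_le _ _).trans ?_
  simp [Finset.card_univ]

/-- `deg α ≤ 2 N⁴`. [cite: BurgisserClausenShokrollahi1997, Prop. (21.15)] -/
theorem totalDegree_nnAlpha_le : (nnAlpha N k).totalDegree ≤ N ^ 4 * 2 := by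
  unfold nnAlpha
  refine (totalDegree_prod_le_of_le _ _ _ fun pq _ =>
    totalDegree_one_sub_X_mul_X_le _ _).trans ?_
  exact Nat.mul_le_mul_right 2 (card_nnBadPairs_le _)

/-- `deg ω ≤ N²`. [cite: BurgisserClausenShokrollahi1997, Prop. (21.15)] -/
theorem totalDegree_nnOmega_le : (nnOmega N k).totalDegree ≤ N * N * 1 := by
  unfold nnOmega
  refine (totalDegree_prod_le_of_le _ _ _ fun a _ => totalDegree_one_sub_X_le _).trans ?_
  exact Nat.mul_le_mul_right 1 (card_filter_arcs_le N _)

/-- `deg β ≤ N`. [cite: BurgisserClausenShokrollahi1997, Prop. (21.15)] -/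
theorem totalDegree_nnBeta_le : (nnBeta N k).totalDegree ≤ N * 1 := by
  unfold nnBeta
  refine (totalDegree_prod_le_of_le _ _ _ fun v _ =>
    totalDegree_sum_le_of_le _ _ _ fun a _ => totalDegree_X_le_one _).trans ?_
  simp

/-- `deg μ ≤ 2 N²`. [cite: BurgisserClausenShokrollahi1997, Prop. (21.15)] -/
theorem totalDegree_nnCover_le : (nnCover N k).totalDegree ≤ N * N * 2 := by
  unfold nnCover
  refine (totalDegree_prod_le_of_le _ _ _ fun a _ => totalDegree_coverFactor_le _ _).trans ?_
  simp [Finset.card_univ]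

/-- `deg G_N ≤ 2 N⁴ + 3 N² + N`. [cite: BurgisserClausenShokrollahi1997, Prop. (21.15)] -/
theorem totalDegree_nnWitness_le :
    (nnWitness N k).totalDegree ≤ N ^ 4 * 2 + N * N * 1 + N * 1 + N * N * 2 := by
  have h1 := totalDegree_nnAlpha_le N k
  have h2 := totalDegree_nnOmega_le N k
  have h3 := totalDegree_nnBeta_le N k
  have h4 := totalDegree_nnCover_le N k
  unfold nnWitness
  refine (totalDegree_mul _ _).trans ?_
  refine (add_le_add ((totalDegree_mul _ _).trans (add_le_add (totalDegree_mul _ _) le_rfl)) le_rfl).trans ?_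
  omega

/-- `L(α) ≤ 4 N⁴`. [cite: BurgisserClausenShokrollahi1997, Prop. (21.15)] -/
theorem complexity_nnAlpha_le : complexity (nnAlpha N k) ≤ N ^ 4 * 3 + N ^ 4 := by
  unfold nnAlpha
  refine (complexity_prod_le_of_le _ _ _ fun pq _ => complexity_one_sub_X_mul_X_le _ _).trans ?_
  have h := card_nnBadPairs_le N
  gcongr

/-- `L(ω) ≤ 3 N²`. [cite: BurgisserClausenShokrollahi1997, Prop. (21.15)] -/
theorem complexity_nnOmega_le : complexity (nnOmega N k) ≤ N * N * 2 + N * N := by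
  unfold nnOmega
  refine (complexity_prod_le_of_le _ _ _ fun a _ => complexity_one_sub_X_le _).trans ?_
  have h := card_filter_arcs_le N (fun a : Fin N × Fin N => ¬ a.1 < a.2)
  gcongr

/-- `L(β) ≤ N³ + N` (inputs are free). [cite: BurgisserClausenShokrollahi1997, Prop. (21.15)] -/
theorem complexity_nnBeta_le : complexity (nnBeta N k) ≤ N * (N * N) + N := by
  unfold nnBeta
  have hf : ∀ v ∈ (Finset.univ : Finset (Fin N)),
      complexity (∑ a ∈ Finset.univ.filter (fun a : Fin N × Fin N => a.1 = v ∨ a.2 = v),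
        (X (Sum.inr (finProdFinEquiv a)) : MvPolynomial (NNVars N) k)) ≤ N * N := by
    intro v _
    refine (complexity_sum_le_of_le _ _ 0 fun a _ => le_of_eq (complexity_X_holds (k := k) _)).trans ?_
    rw [Nat.mul_zero, Nat.zero_add]
    exact card_filter_arcs_le N _
  refine (complexity_prod_le_of_le _ _ _ hf).trans ?_
  simp

/-- `L(μ) ≤ 5 N²`. [cite: BurgisserClausenShokrollahi1997, Prop. (21.15)] -/
theorem complexity_nnCover_le : complexity (nnCover N k) ≤ N * N * 4 + N * N := by
  unfold nnCover
  refine (complexity_prod_le_of_le _ _ _ fun a _ => complexity_coverFactor_le _ _).trans ?_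
  simp [Finset.card_univ]

/-- `L(G_N) ≤ 4 N⁴ + N³ + 8 N² + N + 3`. [cite: BurgisserClausenShokrollahi1997, Prop. (21.15)] -/
theorem complexity_nnWitness_le :
    complexity (nnWitness N k) ≤
      (N ^ 4 * 3 + N ^ 4) + (N * N * 2 + N * N) + (N * (N * N) + N) + (N * N * 4 + N * N) + 3 := by
  have h1 := complexity_nnAlpha_le N k
  have h2 := complexity_nnOmega_le N k
  have h3 := complexity_nnBeta_le N k
  have h4 := complexity_nnCover_le N k
  have h5 := complexity_mul_le_holds (nnAlpha N k) (nnOmega N k)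
  have h6 := complexity_mul_le_holds (nnAlpha N k * nnOmega N k) (nnBeta N k)
  have h7 := complexity_mul_le_holds (nnAlpha N k * nnOmega N k * nnBeta N k) (nnCover N k)
  unfold nnWitness
  omega

/-- `deg NN_N ≤ N`. [folklore] -/
theorem totalDegree_nnPoly_le : (nnPoly N k).totalDegree ≤ N := by
  unfold nnPoly
  refine totalDegree_sum_le_of_le _ _ _ fun M _ => ?_
  split_ifs
  · refine (totalDegree_prod_le_of_le _ _ 1 fun i _ => ?_).trans (by simp)
    split_ifs
    · exact totalDegree_X_le_one _
    · rw [totalDegree_one]; exact Nat.zero_le _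
  · rw [totalDegree_zero]; exact Nat.zero_le _

end Bounds

/-! ### The witness family and `NN ∈ VNP` -/

section Family

variable (k : Type u) [CommRing k]


/-- `(2n+1)^4 ≤ 16 (n+1)^4`. [folklore] -/
theorem two_mul_add_one_pow_four_le (n : ℕ) : (2 * n + 1) ^ 4 ≤ 16 * (n + 1) ^ 4 := by
  have : 2 * n + 1 ≤ 2 * (n + 1) := by omega
  calc (2 * n + 1) ^ 4 ≤ (2 * (n + 1)) ^ 4 := Nat.pow_le_pow_left this 4
    _ = 16 * (n + 1) ^ 4 := by ring

/-- **The witness family is in `VP`**: `8n²` variables, degree `O(n⁴)`, complexity `O(n⁴)`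
(BCS 1997, proof of Prop. (21.15): `G ∈ VP`). [cite: BurgisserClausenShokrollahi1997, Prop. (21.15)] -/
theorem isVPFamily_nnVNPFamily : IsVPFamily (nnVNPFamily k) := by
  refine ⟨⟨(IsPBounded.iff_exists_le_mul_succ_pow _).2 ⟨8, 2, fun n => ?_⟩,
    (IsPBounded.iff_exists_le_mul_succ_pow _).2 ⟨6 * 16, 4, fun n => ?_⟩⟩,
    (IsPBounded.iff_exists_le_mul_succ_pow _).2 ⟨17 * 16, 4, fun n => ?_⟩⟩
  · simp only [Fintype.card_sum, Fintype.card_prod, Fintype.card_fin]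
    nlinarith
  · dsimp only
    refine (totalDegree_nnWitness_le (2 * n) k).trans ?_
    have h := two_mul_add_one_pow_four_le n
    have h1 : (2 * n) ^ 4 ≤ (2 * n + 1) ^ 4 := Nat.pow_le_pow_left (Nat.le_succ _) 4
    have h2 : 2 * n * (2 * n) ≤ (2 * n + 1) ^ 4 := by nlinarith
    have h3 : 2 * n ≤ (2 * n + 1) ^ 4 := by nlinarith
    nlinarith
  · dsimp only
    refine (complexity_nnWitness_le (2 * n) k).trans ?_
    have h := two_mul_add_one_pow_four_le n
    have h1 : (2 * n) ^ 4 ≤ (2 * n + 1) ^ 4 := Nat.pow_le_pow_left (Nat.le_succ _) 4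
    have h2 : 2 * n * (2 * n) ≤ (2 * n + 1) ^ 4 := by nlinarith
    have h3 : 2 * n ≤ (2 * n + 1) ^ 4 := by nlinarith
    have h4 : 2 * n * (2 * n * (2 * n)) ≤ (2 * n + 1) ^ 4 := by nlinarith
    have h5 : 3 ≤ 3 * (2 * n + 1) ^ 4 := by nlinarith
    nlinarith

/-- `NN` is a p-family: `4n²` variables and degree `≤ 2n`. [folklore] -/
theorem isPFamily_nnPoly :
    IsPFamily (σ := fun n => Fin (2 * n) × Fin (2 * n)) (fun n => nnPoly (2 * n) k) := by
  refine ⟨(IsPBounded.iff_exists_le_mul_succ_pow _).2 ⟨4, 2, fun n => ?_⟩,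
    (IsPBounded.iff_exists_le_mul_succ_pow _).2 ⟨2, 1, fun n => ?_⟩⟩
  · simp only [Fintype.card_prod, Fintype.card_fin]
    nlinarith
  · exact (totalDegree_nnPoly_le (2 * n) k).trans (by nlinarith)

/-- **`NN ∈ VNP` over every commutative ring** (Valiant 1979; BCS 1997, Prop. (21.15); Bürgisser 2000,
Def. 2.5): the nest-free matching family is p-definable, with witness `nnVNPFamily` and Boolean sum of
length `(2n)²`. [cite: BurgisserClausenShokrollahi1997, Prop. (21.15)] -/
theorem isVNPFamily_nnPoly :
    IsVNPFamily (σ := fun n => Fin (2 * n) × Fin (2 * n)) (fun n => nnPoly (2 * n) k) :=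
  ⟨isPFamily_nnPoly k, fun n => 2 * n * (2 * n), nnVNPFamily k, isVPFamily_nnVNPFamily k,
    fun n => (boolSum_nnWitness (2 * n) k).symm⟩

end Family

/-! ### The route item -/

/-- **Item `NNInVNP` (stmt-ValiantsHypothesis-11618), PROVED.** The nest-free (FIFO) perfect matching
family `NN_n = ∑_{M} ∏_{i < M i} x_{i, M i}` (sum over nest-free fixed-point-free involutions `M` of
`[2n]`) is a `VNP` family over `ℂ`, by Valiant's criterion in the recogniser form of BCS 1997,
Prop. (21.15) (`isVNPFamily_nnPoly`). Honest framing: a membership lemma for the route's candidate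
family; the crux `NNNotVP` is open. [cite: BurgisserClausenShokrollahi1997, Prop. (21.15)] -/
theorem nnInVNP_proof : NNInVNP :=
  isVNPFamily_nnPoly ℂ

end Summit.ValiantsHypothesis.ValiantsHypothesis.Theorems.FifoMatching

end
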